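import Literature.NumberTheory.Sieve.PolynomialCongruencesRootCount
import Literature.NumberTheory.Sieve.BatemanHornLocalCounts
import Literature.NumberTheory.Sieve.BatemanHornProofs
import HarnessLib

/-!
# Route `SelbergDelangeRigidity`, crux `LSDRealSegment` (stmt-Parity-9770), line
# `product-anatomy-subcritical`: root counts of the PRODUCT system modulo prime powers
# (helper of `stub_eulerFactor`, reusable by `stub_typeI`)

For a Bateman–Horn system `f = (f₁, …, f_k)` (`Literature.NumberTheory.Sieve.IsBatemanHornSystem`) put
`F = ∏ᵢ fᵢ` and `ρ_F(m) = polyRootCountMod f m = #{n < m : m ∣ ∏ᵢ fᵢ(n)}` (`= polyRootCountMod ![F] m`).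
Since the `fᵢ` are irreducible of positive degree and pairwise non-associated, `F` is SEPARABLE over `ℚ`
(Gauss's lemma), so `F A + F' B = R` with an integer `R ≠ 0` (`exists_prod_mul_add_derivative_mul_eq_C`,
Mathlib's `Polynomial.exists_mul_add_mul_eq_C_resultant` / `Polynomial.resultant_eq_zero_iff`).  Feeding this
identity to the tree's Hensel / Nagell counts (`Literature/NumberTheory/Sieve/PolynomialCongruencesRootCount.lean`):

* `exists_polyRootCountMod_prime_pow_le_of_system` — UNIFORM bound: `ρ_F(p^a) ≤ C(f)` for every prime `p`
  and every `a` (Nagell-type bound `polyRootCountMod_prime_pow_le_of_resultant`);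
* `exists_polyRootCountMod_prime_pow_eq_of_system` — at the good primes (`p ∤ R · lc F`, so all `p > P₀`):
  `ρ_F(p^a) = ρ_F(p) ≤ Σᵢ deg fᵢ` for `a ≥ 1` (Hardy–Wright Thm 123, `polyRootCountMod_prime_pow_eq`);
* `eulerFactorAux_rootCountPow` — the registered helper statement (per-prime boundedness and the uniform
  bound at large primes), the input making the local factor `E_p(z) = 1 + (z − 1) Σ_a ρ_F(p^{a+1}) p^{-a-1} z^a`
  a power series of radius `≥ p`.
-/

open Filter Finset Polynomial
open scoped BigOperators Topology Classical

namespace Summit.Parity.BatemanHorn.Cruxes.LSDRealSegment.ProductAnatomySubcritical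

open Literature.NumberTheory.Sieve
open ArithmeticFunction (cardFactors)
noncomputable section

variable {k : ℕ}

/-- `ρ` of the system `f` is `ρ` of the one-member family `![∏ᵢ fᵢ]` (`(∏ fᵢ)(n) = ∏ fᵢ(n)`). [folklore] -/
theorem polyRootCountMod_eq_single_prod (f : Fin k → ℤ[X]) (m : ℕ) :
    polyRootCountMod f m = polyRootCountMod ![∏ i, f i] m := by
  rw [polyRootCountMod_single]
  unfold polyRootCountMod
  simp only [eval_prod]

/-- **The product of a Bateman–Horn system is separable**: `F A + F' B = R` with an integer `R ≠ 0` for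
`F = ∏ᵢ fᵢ` (over `ℚ` the `fᵢ` are irreducible — Gauss — hence separable, and pairwise coprime since
pairwise non-associated; so `Res(F, F') ≠ 0`). [folklore] -/
theorem exists_prod_mul_add_derivative_mul_eq_C {f : Fin k → ℤ[X]} (hf : IsBatemanHornSystem f) :
    ∃ (A B : ℤ[X]) (R : ℤ), R ≠ 0 ∧ (∏ i, f i) * A + derivative (∏ i, f i) * B = C R := by
  set F : ℤ[X] := ∏ i, f i with hF
  have hF0 : F ≠ 0 := Finset.prod_ne_zero_iff.mpr fun i _ => (hf.irreducible i).ne_zero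
  rcases Nat.eq_zero_or_pos F.natDegree with h0 | hdeg
  · refine ⟨1, 0, F.coeff 0, fun hc => hF0 ?_, ?_⟩
    · rw [eq_C_of_natDegree_eq_zero h0, hc, C_0]
    · rw [mul_one, mul_zero, add_zero]
      exact eq_C_of_natDegree_eq_zero h0
  obtain ⟨A, B, -, -, hAB⟩ := exists_mul_add_mul_eq_C_resultant F (derivative F) (le_refl _)
    (natDegree_derivative_le F) (Or.inl hdeg.ne')
  refine ⟨A, B, _, fun hR => ?_, hAB⟩
  set φ := Int.castRingHom ℚ
  have hprim : ∀ i, (f i).IsPrimitive := fun i =>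
    (hf.irreducible i).isPrimitive (hf.natDegree_pos i).ne'
  have hirrQ : ∀ i, Irreducible ((f i).map φ) := fun i =>
    (IsPrimitive.Int.irreducible_iff_irreducible_map_cast (hprim i)).mp (hf.irreducible i)
  have hsepQ : (F.map φ).Separable := by
    rw [hF, Polynomial.map_prod]
    refine separable_prod (fun i j hij => ?_) fun i => (hirrQ i).separable
    refine (hirrQ i).coprime_iff_not_dvd.mpr fun hdvd => hf.pairwise_not_associated hij ?_
    exact (hf.irreducible i).associated_of_dvd (hf.irreducible j)
      ((IsPrimitive.Int.dvd_iff_map_cast_dvd_map_cast (f i) (f j) (hprim i)).mpr hdvd)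
  have e1 : (F.map φ).natDegree = F.natDegree := natDegree_map_eq_of_injective φ.injective_int F
  have e2 : (derivative (F.map φ)).natDegree = F.natDegree - 1 := by
    rw [derivative_map, natDegree_map_eq_of_injective φ.injective_int, natDegree_derivative]
  have hresQ : resultant (F.map φ) (derivative (F.map φ)) (F.map φ).natDegree
      (derivative (F.map φ)).natDegree = 0 := by
    rw [e1, e2, derivative_map, resultant_map_map, hR, map_zero]
  obtain ⟨-, hnc⟩ := resultant_eq_zero_iff.mp hresQ
  exact hnc hsepQ

/-- **Uniform Nagell bound for the product system**: for a Bateman–Horn system there is `C = C(f)` with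
`ρ_F(p^a) ≤ C` for EVERY prime `p` and every `a` (`C = (deg F + 1) R²`: trivially `ρ ≤ p^a ≤ p^{2δ} ≤ R²` for
`a ≤ 2δ`, `p^δ ∥ R`; `ρ ≤ (deg F) p^δ` for `a > 2δ` by Hensel lifting in `ℤ_p`). [folklore] -/
theorem exists_polyRootCountMod_prime_pow_le_of_system {f : Fin k → ℤ[X]}
    (hf : IsBatemanHornSystem f) :
    ∃ C : ℕ, ∀ p : ℕ, p.Prime → ∀ a : ℕ, polyRootCountMod f (p ^ a) ≤ C := by
  obtain ⟨A, B, R, hR, hAB⟩ := exists_prod_mul_add_derivative_mul_eq_C hf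
  set F : ℤ[X] := ∏ i, f i with hF
  refine ⟨(F.natDegree + 1) * R.natAbs ^ 2, fun p hp a => ?_⟩
  haveI := Fact.mk hp
  rw [polyRootCountMod_eq_single_prod]
  set δ := padicValInt p R with hδ
  have hpδ : p ^ δ ≤ R.natAbs :=
    Nat.le_of_dvd (Nat.pos_of_ne_zero (Int.natAbs_ne_zero.2 hR)) pow_padicValNat_dvd
  rcases lt_or_ge a (2 * δ + 1) with ha | ha
  · calc polyRootCountMod ![F] (p ^ a) ≤ p ^ a := polyRootCountMod_le _ _
      _ ≤ p ^ (2 * δ) := Nat.pow_le_pow_right hp.pos (by omega)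
      _ = (p ^ δ) ^ 2 := by rw [← pow_mul, mul_comm]
      _ ≤ R.natAbs ^ 2 := Nat.pow_le_pow_left hpδ 2
      _ ≤ (F.natDegree + 1) * R.natAbs ^ 2 := Nat.le_mul_of_pos_left _ (Nat.succ_pos _)
  · calc polyRootCountMod ![F] (p ^ a) ≤ F.natDegree * p ^ δ :=
          polyRootCountMod_prime_pow_le_of_resultant hR hAB ha
      _ ≤ (F.natDegree + 1) * R.natAbs := Nat.mul_le_mul (Nat.le_succ _) hpδ
      _ ≤ (F.natDegree + 1) * R.natAbs ^ 2 := Nat.mul_le_mul_left _ (by nlinarith)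

/-- **Hensel at the good primes of the product system**: for a Bateman–Horn system there is `P₀`
(`= |R · lc F|`) such that for every prime `p > P₀` and every `a ≥ 1`, `ρ_F(p^a) = ρ_F(p) ≤ Σᵢ deg fᵢ`
(simple roots lift uniquely; Lagrange). [folklore] -/
theorem exists_polyRootCountMod_prime_pow_eq_of_system {f : Fin k → ℤ[X]}
    (hf : IsBatemanHornSystem f) :
    ∃ P₀ : ℕ, ∀ p : ℕ, p.Prime → P₀ < p → ∀ a : ℕ, 1 ≤ a →
      polyRootCountMod f (p ^ a) = polyRootCountMod f p ∧
        polyRootCountMod f p ≤ ∑ i, (f i).natDegree := by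
  obtain ⟨A, B, R, hR, hAB⟩ := exists_prod_mul_add_derivative_mul_eq_C hf
  set F : ℤ[X] := ∏ i, f i with hF
  have hf0 : ∀ i, f i ≠ 0 := fun i => (hf.irreducible i).ne_zero
  have hdegF : F.natDegree = ∑ i, (f i).natDegree := natDegree_prod _ _ fun i _ => hf0 i
  have hlc : F.leadingCoeff ≠ 0 :=
    leadingCoeff_ne_zero.mpr (Finset.prod_ne_zero_iff.mpr fun i _ => hf0 i)
  refine ⟨(R * F.leadingCoeff).natAbs, fun p hp hP a ha => ?_⟩
  have hpE : ¬ (p : ℤ) ∣ R * F.leadingCoeff := by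
    intro h
    have h1 : p ∣ (R * F.leadingCoeff).natAbs := Int.natCast_dvd.mp h
    have h2 := Nat.le_of_dvd (Int.natAbs_pos.mpr (mul_ne_zero hR hlc)) h1
    omega
  have hpR : ¬ (p : ℤ) ∣ R := fun h => hpE (dvd_mul_of_dvd_left h _)
  have hplc : ¬ (p : ℤ) ∣ F.leadingCoeff := fun h => hpE (dvd_mul_of_dvd_right h _)
  rw [polyRootCountMod_eq_single_prod f (p ^ a), polyRootCountMod_eq_single_prod f p, ← hdegF]
  exact ⟨polyRootCountMod_prime_pow_eq hp
      (fun μ hμ => not_dvd_derivative_eval_of_not_dvd hAB hpR hμ) ha,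
    polyRootCountMod_single_le_natDegree hp hplc⟩

/-- **eulerFactorAux_rootCountPow** (registered helper sub-goal of `stub_eulerFactor`, line
`product-anatomy-subcritical`): for a Bateman–Horn system the root counts of the PRODUCT modulo prime
powers, `ρ_F(p^a) = polyRootCountMod f (p^a)`, are (i) bounded in `a` at every prime `p`, and
(ii) bounded by one constant `D` (`= Σ deg fᵢ`) at all primes `p > P₀` and all `a ≥ 1`. [folklore] -/
theorem eulerFactorAux_rootCountPow : ∀ (k : ℕ) (f : Fin k → ℤ[X]), IsBatemanHornSystem f →
    (∀ p : ℕ, p.Prime → ∃ C : ℕ, ∀ a : ℕ, polyRootCountMod f (p ^ a) ≤ C) ∧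
    (∃ P₀ D : ℕ, ∀ p : ℕ, p.Prime → P₀ < p → ∀ a : ℕ, 1 ≤ a → polyRootCountMod f (p ^ a) ≤ D) := by
  intro k f hf
  obtain ⟨C, hC⟩ := exists_polyRootCountMod_prime_pow_le_of_system hf
  obtain ⟨P₀, hP₀⟩ := exists_polyRootCountMod_prime_pow_eq_of_system hf
  refine ⟨fun p hp => ⟨C, hC p hp⟩, P₀, ∑ i, (f i).natDegree, fun p hp hP a ha => ?_⟩
  obtain ⟨h1, h2⟩ := hP₀ p hp hP a ha
  exact h1.le.trans h2

end

end Summit.Parity.BatemanHorn.Cruxes.LSDRealSegment.ProductAnatomySubcritical
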